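import Mathlib.Tactic.NoncommRing

/-!
# Fibre test (W³)₄: a common inert index direction kills the cubic form

HONEST FRAMING. Kernel anchor for the computation cell `pub-hsemireg` (target seat t-5 gen 25; file of
record `run/shared/lean/pub/pub-hsemireg/target-g6/INDEC-LINKS-t5g25.md` v1.3 §8, 2026-08-25). In the
cell's four-level fibre-test model a closed class has three level-preserving components `B₁ B₂ B₃`
(indexed by the three pencil directions) and the cubic form is
`T(B,B′,B″) = Σ_σ sgn σ · B_{σ1} B′_{σ2} B″_{σ3}`; the conjecture (W³)₄ says `str T = 0`.
The census of the note finds, on every INDECOMPOSABLE four-level pencil examined (≈ 1 000 summands,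
exact toric beds included), a COMMON INERT DIRECTION: an index direction `a₀` such that the component
`B(a₀)` of every closed class annihilates every component of every closed class from both sides
(law (CID)₄; it fails at five and six levels exactly on the indecomposables with `T ≠ 0`).
This file records the elementary algebra that turns (CID) into the vanishing of `T`, in an arbitrary
ring and in a frame whose third index is the inert direction:
* `cubicForm_eq_zero_of_inert_third` — if the third components `c, c′, c″` of three classes multiply
  to zero against the neighbouring components (six instances of inertness), then `T = 0`;
* `cross_eq_zero_of_two_inert` — if two index directions are inert, all three cross components
  `(B×B′)_l = Σ ε_{ijl} B_i B′_j` vanish (so `dim CID ≥ 2 ⇒ B×B′ ≡ 0`, the «vertex type» of the note).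
Nothing here asserts (CID)₄, (W³)₄, HC, HC_CM or HC_AV; the identification of this algebra with
`Ext` groups is the cell's model and is not formalised here.
-/

namespace Summit.Ventures.HSemireg.CommonInertDirection

/-- **Common inert direction ⇒ cubic form zero.** In any ring, let `(a,b,c)`, `(a′,b′,c′)`,
`(a″,b″,c″)` be the components of three classes in a frame whose third index is inert. The six
products of a third component with an adjacent component that occur in the six terms of
`T = Σ_σ sgn σ · B_{σ1} B′_{σ2} B″_{σ3}` vanish by inertness; hence `T = 0`. -/
theorem cubicForm_eq_zero_of_inert_third {R : Type*} [Ring R]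
    (a b c a' b' c' a'' b'' c'' : R)
    (h1 : b' * c'' = 0) (h2 : b * c' = 0) (h3 : c * a' = 0)
    (h4 : a * c' = 0) (h5 : c * b' = 0) (h6 : a' * c'' = 0) :
    a * b' * c'' + b * c' * a'' + c * a' * b''
      - a * c' * b'' - c * b' * a'' - b * a' * c'' = 0 := by
  have e1 : a * b' * c'' = 0 := by rw [mul_assoc, h1, mul_zero]
  have e2 : b * c' * a'' = 0 := by rw [h2, zero_mul]
  have e3 : c * a' * b'' = 0 := by rw [h3, zero_mul]
  have e4 : a * c' * b'' = 0 := by rw [h4, zero_mul]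
  have e5 : c * b' * a'' = 0 := by rw [h5, zero_mul]
  have e6 : b * a' * c'' = 0 := by rw [mul_assoc, h6, mul_zero]
  rw [e1, e2, e3, e4, e5, e6]; noncomm_ring

/-- **Two inert directions ⇒ the cross product vanishes.** If the second and third index
directions are inert (their components multiply to zero against every component of the other
class, on the side where they meet), then all three components of
`B×B′ = (b c′ − c b′, c a′ − a c′, a b′ − b a′)` vanish. -/
theorem cross_eq_zero_of_two_inert {R : Type*} [Ring R]
    (a b c a' b' c' : R)
    (hb1 : b * c' = 0) (hc1 : c * b' = 0) (hc2 : c * a' = 0) (hc3 : a * c' = 0)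
    (hb2 : a * b' = 0) (hb3 : b * a' = 0) :
    b * c' - c * b' = 0 ∧ c * a' - a * c' = 0 ∧ a * b' - b * a' = 0 := by
  refine ⟨?_, ?_, ?_⟩
  · rw [hb1, hc1, sub_zero]
  · rw [hc2, hc3, sub_zero]
  · rw [hb2, hb3, sub_zero]

end Summit.Ventures.HSemireg.CommonInertDirection
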